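import Summits.QuantumFields.YangMills.Theorems.FluctuationComparisonRegPrIntLS2BetaCurlBudgetLetter
import Summits.QuantumFields.YangMills.Theorems.FluctuationComparisonRegPrIntLS2BetaCoarseCurlJunction
import HarnessLib

/-!
# S2β · (SCT″-c)₁ (SRC-E) consumer side — «THE THREE SOURCE CLASSES READ OFF THE (BKG) BINDER»: under the station's background binder
# `∀ t ≤ K−J, ∀ p, dist1 (U(∂p)(Ū^t U₀)) ≤ θ_t := C_B·α·L^{2t}·(L⁻¹)^{2(K−J)}` the three class letters of ✓`c1Budget_of_letters` (✓p838904) ∕ ✓`Bsrc_split_le` (✓p839415)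
# are INHABITED by explicit witnesses — `δ(i+1) := 2θ_i` (strict plaquette window of `Ū^i U₀`), `α(i+1) := (((d+2)L)²∕4)·θ_i` (its (0.4) loop variables),
# `αp μ ν (i+1) := θ_{i+1} = L²·θ_i` (the plaquettes of `Ū^{i+1} U₀ = avgFun ℰ (Ū^i U₀)`) — with the class relations `δ ≤ Θ`, `α ≤ kα·Θ`, `ᾱp ≤ kp·Θ` of
# ✓`srcCoeff_le_class` (px10 g26 (i)) at `Θ_i := 2θ_i`, `kα := ((d+2)L)²∕4`, `kp := L²`, and the two window guards from ONE smallness `(((d+2)L)²∕4)·C_B·α ≤ 1∕24 ∧ < δ_SU`.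

Cell `ym3-torus` (YM ladder rung R3 = continuum `SU(2)` Yang–Mills on the three-torus at fixed lattice data — a RUNG: NOT d = 4, NOT infinite volume, NOT a mass gap,
NOT Clay).  Width seat `ym-ust-20520-w4` (gen 29); crux `stmt-QuantumFields-20520`, LINE g18-1 S2β; px10 g26's (SRC-E) SPEC (2026-09-01T00:49:48Z) piece (i), CONSUMER side
(px10 g26 01:13:07Z: «class relations `δ(i+1) ≤ θ_i`, `α(i+1) ≤ kα·θ_i`, `ᾱp(i+1) ≤ kp·θ_i` — named, not priced here»).
`--kind proof --supports stmt-QuantumFields-20520 --as helper`, count-neutral, DEFINITION-FREE (0 `def`, 0 `instance`, 0 `notation`, 0 `sorry`, default heartbeats).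

WHAT IS PROVED (sorry-free; (BKG) is a HYPOTHESIS binder, copied BYTE FOR BYTE from ✓`supTowerLetter_of_liftLadderLetter''`).
* §1 the three letters under any STRICT envelope `Θ` of the background classes (`θ_i < Θ_i`): ★`plaqSmall_iter_of_bkg` (`PlaqSmall (Θ i) (Ū^i U₀)`),
  ★`dist1_loopHol_iter_le_of_bkg` (`dist1 (loopHol (Ū^i U₀) c ι) ≤ (((d+2)L)²∕4)·θ_i`, lit ✓`dist1_loopHol_le'`), ★`dist1_holAt_plaqWord_iter_le_of_bkg`
  (`dist1 (holAt (avgFun ℰ (Ū^i U₀)) (walk y′ [μ⁺,ν⁺,μ̄,ν̄])) ≤ θ_{i+1}`, ✓`holAt_walk_plaq_eq_plaqHol` + `Ū^{i+1} = avgFun ℰ (Ū^i)` (rfl)).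
* §2 the arithmetic of the classes: ★`bkgClass_nonneg`, ★`bkgClass_lt_two_mul` (`θ_i < 2θ_i` for `0 < C_B·α`, `0 < L`), ★`bkgClass_le_base` (`θ_i ≤ C_B·α` for `i ≤ K−J`, `1 ≤ L`),
  ★`bkgClass_succ_eq` (`θ_{i+1} = L²·θ_i`).
* §3 ★★★`exists_srcClasses_of_bkg`: ONE ∃-package `∃ α δ αp ᾱp` whose conjuncts are ✓`c1Budget_of_letters`'s binders `hα`, `hα24`, `hαδ`, `hα0`, `hδ`, `hUs`, `hαp0`, `hαp`
  VERBATIM, ✓`Bsrc_split_le`'s `hδ0`∕`hαpb`, and the three class relations at `Θ_i := 2·C_B·α·L^{2i}·(L⁻¹)^{2(K−J)}` with `kα := ((d+2)L)²∕4`, `kp := L²` —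
  and ★★★`exists_srcClasses_of_bkg'`: the same with the relations in the EXACT `hδ`∕`hα`∕`hαp` binder shapes of the (SRC-E) assembly `Elin_le_purse` (px10 g26 f75d22d3:
  `θ_i := Cθ·L^{2i} ∕ L^{2(K−J)}`, any `Cθ ≥ 2·C_B·α`, `kα := ((d+2)L)²∕4`, `kp := L²`) — so the c₁ column's linear energy is priced with NO class letter left.

HONEST SCOPE.  Bookkeeping over the (BKG) HYPOTHESIS binder (lattice Stokes for the (0.4) loop words, [Balaban1985Averaging] (19)–(20) p.21; the small-field window
[Balaban1987RG1] (0.18) p.255); nothing of Bałaban's renormalisation-group analysis is asserted or proved; (BKG) itself, (L2-TOWER), (REG), (SUP-DECAY)₀ are NOT here;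
GAP♯∘ (`stub_uniformFibreGapOrbit`, registry 3732b7df UNTOUCHED, 0∕5), S2β, the five registered stubs, crux 20520, 19936, 19200 and `YM3TorusSU2` are NOT proved; no
registered stub is closed; rung R3 — NOT d = 4, NOT infinite volume, NOT a mass gap, NOT Clay; the Yang–Mills mass gap is NOT proved.
-/

set_option autoImplicit false

open scoped Matrix.Norms.L2Operator

namespace Summit.QuantumFields.YangMills.Theorems.FluctuationComparisonRegPrIntLS2BetaSourceClassesOfBkg

open Literature.MathematicalPhysics.QuantumFieldTheory.Balaban1983to89
open Literature.MathematicalPhysics.QuantumFieldTheory.Balaban1983to89.T4Continuum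
open Literature.MathematicalPhysics.QuantumFieldTheory.Balaban1983to89.T3ContinuumYM3Torus
open Literature.MathematicalPhysics.QuantumFieldTheory.Balaban1983to89.T3UnitLawDensityEML (ℰp)
open Literature.MathematicalPhysics.QuantumFieldTheory.Balaban1983to89.BlockAveraging (Idx blockAvg avgFun loopHol)
open Literature.MathematicalPhysics.QuantumFieldTheory.Balaban1983to89.ExpMeanLog (expMeanLogSU deltaSU)
open Literature.MathematicalPhysics.QuantumFieldTheory.Balaban1983to89.BlockAveragingEMLProp2 (dist1_loopHol_le')
open Summit.QuantumFields.YangMills.Theorems.FluctuationComparisonRegPrIntLS2BetaCoarseCurlJunction (holAt_walk_plaq_eq_plaqHol)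

variable (F : T3Family)

/-! ## §1 The three letters under a strict envelope of the background classes -/

section Letters

variable {J K : ℕ} (U₀ : GaugeField (F.P K) 0 (Matrix.specialUnitaryGroup (Fin 2) ℂ)) (C_B α : ℝ)

/-- ★ **STRICT PLAQUETTE WINDOW OF THE BACKGROUND TOWER**: under (BKG), every strict envelope `Θ_i > θ_i := C_B·α·L^{2i}·(L⁻¹)^{2(K−J)}` is a `PlaqSmall` window of `Ū^i U₀`
(`i < K − J`) — ✓`c1Budget_of_letters`'s `hUs` with `δ(i+1) := Θ_i`. [cite: Balaban1987RG1, (0.18) p.255] -/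
theorem plaqSmall_iter_of_bkg
    (hBKG : ∀ t, t ≤ K - J → ∀ p : Plaq (F.P K) t,
      dist1 (GaugeField.plaqHol (Averaging.iter (fun k => BlockAveraging.blockAvg (P := F.P K) (j := k) ℰp) t U₀) p) ≤
        C_B * α * (F.L : ℝ) ^ (2 * t) * ((F.L : ℝ)⁻¹) ^ (2 * (K - J)))
    (Θ : ℕ → ℝ) (hΘ : ∀ i, i < K - J → C_B * α * (F.L : ℝ) ^ (2 * i) * ((F.L : ℝ)⁻¹) ^ (2 * (K - J)) < Θ i) :
    ∀ i, i < K - J → PlaqSmall (Θ i) (Averaging.iter (fun k => BlockAveraging.blockAvg (P := F.P K) (j := k) ℰp) i U₀) :=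
  fun i hi p => (hBKG i hi.le p).trans_lt (hΘ i hi)

/-- ★ **THE (0.4) LOOP VARIABLES OF THE BACKGROUND TOWER ARE PLAQUETTE-CLASS**: under (BKG) (`C_B, α ≥ 0`), for `i < K − J`, every loop variable of `Ū^i U₀` at a
coarse bond `c` satisfies `dist1 ≤ (((d+2)L)²∕4)·θ_i` (closed words of length `≤ (d+2)L`, lattice Stokes lit ✓`dist1_loopHol_le'`) — ✓`c1Budget_of_letters`'s `hα` with
`α(i+1) := (((d+2)L)²∕4)·θ_i`. [cite: Balaban1985Averaging, (19)-(20) p.21] -/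
theorem dist1_loopHol_iter_le_of_bkg (hCB : 0 ≤ C_B) (hα : 0 ≤ α)
    (hBKG : ∀ t, t ≤ K - J → ∀ p : Plaq (F.P K) t,
      dist1 (GaugeField.plaqHol (Averaging.iter (fun k => BlockAveraging.blockAvg (P := F.P K) (j := k) ℰp) t U₀) p) ≤
        C_B * α * (F.L : ℝ) ^ (2 * t) * ((F.L : ℝ)⁻¹) ^ (2 * (K - J))) :
    ∀ i, i < K - J → ∀ (c : PBond (F.P K) (i + 1)) (ι : Idx (F.P K)),
      dist1 (loopHol (Averaging.iter (fun k => BlockAveraging.blockAvg (P := F.P K) (j := k) ℰp) i U₀) c ι) ≤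
        ((((F.P K).d + 2) * (F.P K).L : ℕ) : ℝ) ^ 2 / 4 * (C_B * α * (F.L : ℝ) ^ (2 * i) * ((F.L : ℝ)⁻¹) ^ (2 * (K - J))) :=
  fun i hi c ι => dist1_loopHol_le' (by positivity) (fun q => hBKG i hi.le q) c ι

/-- ★ **THE PLAQUETTES OF THE NEXT BACKGROUND LEVEL**: under (BKG), for `μ < ν`, `i < K − J` and a level-`(i+1)` site `y′`, the holonomy of `avgFun ℰ (Ū^i U₀) = Ū^{i+1} U₀`
(rfl) along the plaquette word `[μ⁺, ν⁺, μ̄, ν̄]` from `y′` IS the plaquette variable at `(y′; μ, ν)` (✓`holAt_walk_plaq_eq_plaqHol`), hence `≤ θ_{i+1}` —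
✓`c1Budget_of_letters`'s `hαp` with `αp μ ν (i+1) := θ_{i+1}`. [cite: Balaban1985Averaging, (9) p.19; Balaban1987RG1, (0.18) p.255] -/
theorem dist1_holAt_plaqWord_iter_le_of_bkg
    (hBKG : ∀ t, t ≤ K - J → ∀ p : Plaq (F.P K) t,
      dist1 (GaugeField.plaqHol (Averaging.iter (fun k => BlockAveraging.blockAvg (P := F.P K) (j := k) ℰp) t U₀) p) ≤
        C_B * α * (F.L : ℝ) ^ (2 * t) * ((F.L : ℝ)⁻¹) ^ (2 * (K - J))) :
    ∀ μ ν : Fin (F.P K).d, μ < ν → ∀ i, i < K - J → ∀ y' : Site (F.P K) (i + 1),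
      dist1 (holAt (avgFun (expMeanLogSU (n := Fin 2)) (Averaging.iter (fun k => BlockAveraging.blockAvg (P := F.P K) (j := k) ℰp) i U₀))
        (walk y' [((μ, true) : Letter (F.P K).d), (ν, true), (μ, false), (ν, false)])) ≤
        C_B * α * (F.L : ℝ) ^ (2 * (i + 1)) * ((F.L : ℝ)⁻¹) ^ (2 * (K - J)) := by
  intro μ ν hμν i hi y'
  rw [holAt_walk_plaq_eq_plaqHol _ y' hμν]
  exact hBKG (i + 1) (by omega) ⟨y', μ, ν, hμν⟩

end Letters

/-! ## §2 The arithmetic of the background classes `θ_i := C_B·α·L^{2i}·(L⁻¹)^{2(K−J)}` -/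

section Arithmetic

variable {J K : ℕ} (C_B α : ℝ)

/-- ★ `0 ≤ θ_i` for `C_B, α ≥ 0`. [folklore] -/
theorem bkgClass_nonneg (hCB : 0 ≤ C_B) (hα : 0 ≤ α) (i : ℕ) :
    0 ≤ C_B * α * (F.L : ℝ) ^ (2 * i) * ((F.L : ℝ)⁻¹) ^ (2 * (K - J)) := by positivity

/-- ★ `θ_i < 2·θ_i` as soon as `0 < C_B·α` and `0 < L` (the strictness the `PlaqSmall` window needs). [folklore] -/
theorem bkgClass_lt_two_mul (hpos : 0 < C_B * α) (hL : 0 < (F.L : ℝ)) (i : ℕ) :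
    C_B * α * (F.L : ℝ) ^ (2 * i) * ((F.L : ℝ)⁻¹) ^ (2 * (K - J)) < 2 * (C_B * α * (F.L : ℝ) ^ (2 * i) * ((F.L : ℝ)⁻¹) ^ (2 * (K - J))) :=
  lt_two_mul_self (by positivity)

/-- ★ `θ_i ≤ C_B·α` for `i ≤ K − J` and `1 ≤ L` (`L^{2i}·L^{−2(K−J)} ≤ 1`) — so ONE smallness of `C_B·α` guards every level. [folklore] -/
theorem bkgClass_le_base (hCB : 0 ≤ C_B) (hα : 0 ≤ α) (hL : 1 ≤ (F.L : ℝ)) {i : ℕ} (hi : i ≤ K - J) :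
    C_B * α * (F.L : ℝ) ^ (2 * i) * ((F.L : ℝ)⁻¹) ^ (2 * (K - J)) ≤ C_B * α := by
  have hL0 : 0 < (F.L : ℝ) := by linarith
  have h1 : (F.L : ℝ) ^ (2 * i) * ((F.L : ℝ)⁻¹) ^ (2 * (K - J)) ≤ 1 := by
    rw [inv_pow, ← div_eq_mul_inv, div_le_one (pow_pos hL0 _)]
    exact pow_le_pow_right₀ hL (by omega)
  calc C_B * α * (F.L : ℝ) ^ (2 * i) * ((F.L : ℝ)⁻¹) ^ (2 * (K - J))
      = C_B * α * ((F.L : ℝ) ^ (2 * i) * ((F.L : ℝ)⁻¹) ^ (2 * (K - J))) := by ring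
    _ ≤ C_B * α * 1 := mul_le_mul_of_nonneg_left h1 (mul_nonneg hCB hα)
    _ = C_B * α := mul_one _

/-- ★ `θ_{i+1} = L²·θ_i` (one block step costs two powers of `L`). [folklore] -/
theorem bkgClass_succ_eq (i : ℕ) :
    C_B * α * (F.L : ℝ) ^ (2 * (i + 1)) * ((F.L : ℝ)⁻¹) ^ (2 * (K - J)) =
      (F.L : ℝ) ^ 2 * (C_B * α * (F.L : ℝ) ^ (2 * i) * ((F.L : ℝ)⁻¹) ^ (2 * (K - J))) := by
  rw [show 2 * (i + 1) = 2 * i + 2 by ring, pow_add]; ring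

/-- ★ `2θ_i ≤ Cθ·L^{2i} ∕ L^{2(K−J)}` whenever `2·C_B·α ≤ Cθ` — the envelope `Θ_i := 2θ_i` dominated by the ONE-CONSTANT class `Cθ·L^{2i} ∕ L^{2(K−J)}` that the (SRC-E)
assembly `Elin_le_purse` prints (px10 g26 SIGNATURE f75d22d3, 2026-09-01T01:19:29Z; `(L⁻¹)^{n} = (L^{n})⁻¹`). [folklore] -/
theorem two_mul_bkgClass_le_of_le {Cθ : ℝ} (hCθ : 2 * (C_B * α) ≤ Cθ) (i : ℕ) :
    2 * (C_B * α * (F.L : ℝ) ^ (2 * i) * ((F.L : ℝ)⁻¹) ^ (2 * (K - J))) ≤ Cθ * (F.L : ℝ) ^ (2 * i) / (F.L : ℝ) ^ (2 * (K - J)) := by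
  rw [inv_pow, div_eq_mul_inv]
  have h0 : 0 ≤ (F.L : ℝ) ^ (2 * i) * ((F.L : ℝ) ^ (2 * (K - J)))⁻¹ := by positivity
  calc 2 * (C_B * α * (F.L : ℝ) ^ (2 * i) * ((F.L : ℝ) ^ (2 * (K - J)))⁻¹)
      = (2 * (C_B * α)) * ((F.L : ℝ) ^ (2 * i) * ((F.L : ℝ) ^ (2 * (K - J)))⁻¹) := by ring
    _ ≤ Cθ * ((F.L : ℝ) ^ (2 * i) * ((F.L : ℝ) ^ (2 * (K - J)))⁻¹) := mul_le_mul_of_nonneg_right hCθ h0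
    _ = Cθ * (F.L : ℝ) ^ (2 * i) * ((F.L : ℝ) ^ (2 * (K - J)))⁻¹ := by ring

end Arithmetic

/-! ## §3 The package: `c1Budget_of_letters`' class binders inhabited from (BKG), with the class relations at `Θ_i := 2θ_i` -/

section Package

variable {J K : ℕ} (U₀ : GaugeField (F.P K) 0 (Matrix.specialUnitaryGroup (Fin 2) ℂ)) (C_B α : ℝ)

/-- ★★★ **THE THREE SOURCE CLASSES READ OFF THE (BKG) BINDER.**  Under (BKG) with `0 ≤ C_B`, `0 ≤ α`, `0 < C_B·α`, `1 ≤ L` and ONE smallness of the base class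
`(((d+2)L)²∕4)·(C_B·α) ≤ 1∕24`, `< δ_SU`: there are classes `α δ αp ᾱp` satisfying ✓`c1Budget_of_letters`'s `hα`, `hα24`, `hαδ`, `hα0`, `hδ`, `hUs`, `hαp0`, `hαp` VERBATIM,
✓`Bsrc_split_le`'s `hδ0`, `hαpb`, `0 ≤ ᾱp`, and the class relations of ✓`srcCoeff_le_class` at `Θ_i := 2·C_B·α·L^{2i}·(L⁻¹)^{2(K−J)}`:
`δ(i+1) ≤ Θ_i`, `α(i+1) ≤ (((d+2)L)²∕4)·Θ_i`, `ᾱp(i+1) ≤ L²·Θ_i` (witnesses `δ(i+1) := Θ_i`, `α(i+1) := (((d+2)L)²∕4)·θ_i`, `αp μ ν (i+1) := ᾱp(i+1) := θ_{i+1}`).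
[cite: Balaban1985Averaging, (19)-(20) p.21 and Prop. 4 (128)-(135) pp.37-38; Balaban1987RG1, (0.18) p.255] -/
theorem exists_srcClasses_of_bkg (hCB : 0 ≤ C_B) (hα : 0 ≤ α) (hpos : 0 < C_B * α) (hL : 1 ≤ (F.L : ℝ))
    (hBKG : ∀ t, t ≤ K - J → ∀ p : Plaq (F.P K) t,
      dist1 (GaugeField.plaqHol (Averaging.iter (fun k => BlockAveraging.blockAvg (P := F.P K) (j := k) ℰp) t U₀) p) ≤
        C_B * α * (F.L : ℝ) ^ (2 * t) * ((F.L : ℝ)⁻¹) ^ (2 * (K - J)))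
    (h24 : ((((F.P K).d + 2) * (F.P K).L : ℕ) : ℝ) ^ 2 / 4 * (C_B * α) ≤ 1 / 24)
    (hSU : ((((F.P K).d + 2) * (F.P K).L : ℕ) : ℝ) ^ 2 / 4 * (C_B * α) < deltaSU (Fin 2)) :
    ∃ (αc δc : ℕ → ℝ) (αpc : Fin (F.P K).d → Fin (F.P K).d → ℕ → ℝ) (αpbc : ℕ → ℝ),
      (∀ i, i < K - J → ∀ (c : PBond (F.P K) (i + 1)) (ι : Idx (F.P K)), dist1 (loopHol (Averaging.iter (fun k => BlockAveraging.blockAvg (P := F.P K) (j := k) ℰp) i U₀) c ι) ≤ αc (i + 1)) ∧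
      (∀ i, i < K - J → αc (i + 1) ≤ 1 / 24) ∧ (∀ i, i < K - J → αc (i + 1) < deltaSU (Fin 2)) ∧
      (∀ i, 0 ≤ αc i) ∧ (∀ i, i < K - J → 0 ≤ δc (i + 1)) ∧ (∀ i, i < K - J → PlaqSmall (δc (i + 1)) (Averaging.iter (fun k => BlockAveraging.blockAvg (P := F.P K) (j := k) ℰp) i U₀)) ∧
      (∀ μ ν i, 0 ≤ αpc μ ν i) ∧
      (∀ μ ν : Fin (F.P K).d, μ < ν → ∀ i, i < K - J → ∀ y' : Site (F.P K) (i + 1),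
        dist1 (holAt (avgFun (expMeanLogSU (n := Fin 2)) (Averaging.iter (fun k => BlockAveraging.blockAvg (P := F.P K) (j := k) ℰp) i U₀)) (walk y' [((μ, true) : Letter (F.P K).d), (ν, true), (μ, false), (ν, false)])) ≤ αpc μ ν (i + 1)) ∧
      (∀ i, 0 ≤ δc i) ∧ (∀ μ ν i, αpc μ ν i ≤ αpbc i) ∧ (∀ i, 0 ≤ αpbc i) ∧
      (∀ i, i < K - J →
        δc (i + 1) ≤ 2 * (C_B * α * (F.L : ℝ) ^ (2 * i) * ((F.L : ℝ)⁻¹) ^ (2 * (K - J))) ∧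
        αc (i + 1) ≤ ((((F.P K).d + 2) * (F.P K).L : ℕ) : ℝ) ^ 2 / 4 * (2 * (C_B * α * (F.L : ℝ) ^ (2 * i) * ((F.L : ℝ)⁻¹) ^ (2 * (K - J)))) ∧
        αpbc (i + 1) ≤ (F.L : ℝ) ^ 2 * (2 * (C_B * α * (F.L : ℝ) ^ (2 * i) * ((F.L : ℝ)⁻¹) ^ (2 * (K - J))))) := by
  have hL0 : 0 < (F.L : ℝ) := by linarith
  have hθ0 : ∀ i : ℕ, 0 ≤ C_B * α * (F.L : ℝ) ^ (2 * i) * ((F.L : ℝ)⁻¹) ^ (2 * (K - J)) := bkgClass_nonneg F C_B α hCB hα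
  have hkα0 : (0 : ℝ) ≤ ((((F.P K).d + 2) * (F.P K).L : ℕ) : ℝ) ^ 2 / 4 := by positivity
  refine ⟨fun n => ((((F.P K).d + 2) * (F.P K).L : ℕ) : ℝ) ^ 2 / 4 * (C_B * α * (F.L : ℝ) ^ (2 * (n - 1)) * ((F.L : ℝ)⁻¹) ^ (2 * (K - J))),
    fun n => 2 * (C_B * α * (F.L : ℝ) ^ (2 * (n - 1)) * ((F.L : ℝ)⁻¹) ^ (2 * (K - J))),
    fun _ _ n => C_B * α * (F.L : ℝ) ^ (2 * n) * ((F.L : ℝ)⁻¹) ^ (2 * (K - J)),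
    fun n => C_B * α * (F.L : ℝ) ^ (2 * n) * ((F.L : ℝ)⁻¹) ^ (2 * (K - J)),
    ?_, ?_, ?_, ?_, ?_, ?_, ?_, ?_, ?_, ?_, ?_, ?_⟩
  · -- hα
    intro i hi c ι
    simp only [Nat.add_sub_cancel]
    exact dist1_loopHol_iter_le_of_bkg F U₀ C_B α hCB hα hBKG i hi c ι
  · -- hα24
    intro i hi
    simp only [Nat.add_sub_cancel]
    exact (mul_le_mul_of_nonneg_left (bkgClass_le_base F C_B α hCB hα hL hi.le) hkα0).trans h24
  · -- hαδ
    intro i hi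
    simp only [Nat.add_sub_cancel]
    exact (mul_le_mul_of_nonneg_left (bkgClass_le_base F C_B α hCB hα hL hi.le) hkα0).trans_lt hSU
  · -- hα0
    intro i; exact mul_nonneg hkα0 (hθ0 _)
  · -- hδ
    intro i _; exact mul_nonneg zero_le_two (hθ0 _)
  · -- hUs
    intro i hi
    simp only [Nat.add_sub_cancel]
    exact plaqSmall_iter_of_bkg F U₀ C_B α hBKG (fun n => 2 * (C_B * α * (F.L : ℝ) ^ (2 * n) * ((F.L : ℝ)⁻¹) ^ (2 * (K - J))))
      (fun n _ => bkgClass_lt_two_mul F C_B α hpos hL0 n) i hi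
  · -- hαp0
    intro μ ν i; exact hθ0 _
  · -- hαp
    exact dist1_holAt_plaqWord_iter_le_of_bkg F U₀ C_B α hBKG
  · -- hδ0 (all levels)
    intro i; exact mul_nonneg zero_le_two (hθ0 _)
  · -- hαpb
    intro μ ν i; exact le_rfl
  · -- 0 ≤ ᾱp
    intro i; exact hθ0 _
  · -- class relations at Θ_i := 2θ_i
    intro i hi
    refine ⟨?_, ?_, ?_⟩
    · simp only [Nat.add_sub_cancel]; exact le_rfl
    · simp only [Nat.add_sub_cancel]
      exact mul_le_mul_of_nonneg_left (bkgClass_lt_two_mul F C_B α hpos hL0 i).le hkα0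
    · show C_B * α * (F.L : ℝ) ^ (2 * (i + 1)) * ((F.L : ℝ)⁻¹) ^ (2 * (K - J)) ≤ _
      rw [bkgClass_succ_eq F C_B α i]
      exact mul_le_mul_of_nonneg_left (bkgClass_lt_two_mul F C_B α hpos hL0 i).le (by positivity)

/-- ★★★ **THE SAME PACKAGE DOCKED ONTO THE (SRC-E) ASSEMBLY'S CLASS BINDERS**: for any `Cθ ≥ 2·C_B·α` (the strictness factor of the `PlaqSmall` window) the three
class relations are concluded in the EXACT binder shapes `hδ`∕`hα`∕`hαp` of `Elin_le_purse` (px10 g26 SIGNATURE f75d22d3): `δ(i+1) ≤ Cθ·L^{2i} ∕ L^{2(K−J)}`,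
`α(i+1) ≤ kα·(Cθ·L^{2i} ∕ L^{2(K−J)})` at `kα := ((d+2)L)²∕4`, `ᾱp(i+1) ≤ kp·(…)` at `kp := L²`, with its `hδ0`∕`hα0`∕`hαp0` sign conjuncts and ✓`c1Budget_of_letters`'
letters unchanged. [cite: Balaban1985Averaging, (19)-(20) p.21 and Prop. 4 (128)-(135) pp.37-38; Balaban1987RG1, (0.18) p.255] -/
theorem exists_srcClasses_of_bkg' (hCB : 0 ≤ C_B) (hα : 0 ≤ α) (hpos : 0 < C_B * α) (hL : 1 ≤ (F.L : ℝ))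
    (hBKG : ∀ t, t ≤ K - J → ∀ p : Plaq (F.P K) t,
      dist1 (GaugeField.plaqHol (Averaging.iter (fun k => BlockAveraging.blockAvg (P := F.P K) (j := k) ℰp) t U₀) p) ≤
        C_B * α * (F.L : ℝ) ^ (2 * t) * ((F.L : ℝ)⁻¹) ^ (2 * (K - J)))
    (h24 : ((((F.P K).d + 2) * (F.P K).L : ℕ) : ℝ) ^ 2 / 4 * (C_B * α) ≤ 1 / 24)
    (hSU : ((((F.P K).d + 2) * (F.P K).L : ℕ) : ℝ) ^ 2 / 4 * (C_B * α) < deltaSU (Fin 2))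
    (Cθ : ℝ) (hCθ : 2 * (C_B * α) ≤ Cθ) :
    ∃ (αc δc : ℕ → ℝ) (αpc : Fin (F.P K).d → Fin (F.P K).d → ℕ → ℝ) (αpbc : ℕ → ℝ),
      (∀ i, i < K - J → ∀ (c : PBond (F.P K) (i + 1)) (ι : Idx (F.P K)), dist1 (loopHol (Averaging.iter (fun k => BlockAveraging.blockAvg (P := F.P K) (j := k) ℰp) i U₀) c ι) ≤ αc (i + 1)) ∧
      (∀ i, i < K - J → αc (i + 1) ≤ 1 / 24) ∧ (∀ i, i < K - J → αc (i + 1) < deltaSU (Fin 2)) ∧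
      (∀ i, 0 ≤ αc i) ∧ (∀ i, i < K - J → 0 ≤ δc (i + 1)) ∧ (∀ i, i < K - J → PlaqSmall (δc (i + 1)) (Averaging.iter (fun k => BlockAveraging.blockAvg (P := F.P K) (j := k) ℰp) i U₀)) ∧
      (∀ μ ν i, 0 ≤ αpc μ ν i) ∧
      (∀ μ ν : Fin (F.P K).d, μ < ν → ∀ i, i < K - J → ∀ y' : Site (F.P K) (i + 1),
        dist1 (holAt (avgFun (expMeanLogSU (n := Fin 2)) (Averaging.iter (fun k => BlockAveraging.blockAvg (P := F.P K) (j := k) ℰp) i U₀)) (walk y' [((μ, true) : Letter (F.P K).d), (ν, true), (μ, false), (ν, false)])) ≤ αpc μ ν (i + 1)) ∧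
      (∀ i, 0 ≤ δc i) ∧ (∀ μ ν i, αpc μ ν i ≤ αpbc i) ∧ (∀ i, 0 ≤ αpbc i) ∧
      (∀ i, i < K - J → δc (i + 1) ≤ (Cθ * (F.L : ℝ) ^ (2 * i) / (F.L : ℝ) ^ (2 * (K - J)))) ∧
      (∀ i, i < K - J → αc (i + 1) ≤ ((((F.P K).d + 2) * (F.P K).L : ℕ) : ℝ) ^ 2 / 4 * (Cθ * (F.L : ℝ) ^ (2 * i) / (F.L : ℝ) ^ (2 * (K - J)))) ∧
      (∀ i, i < K - J → αpbc (i + 1) ≤ (F.L : ℝ) ^ 2 * (Cθ * (F.L : ℝ) ^ (2 * i) / (F.L : ℝ) ^ (2 * (K - J)))) := by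
  obtain ⟨αc, δc, αpc, αpbc, h1, h2, h3, h4, h5, h6, h7, h8, h9, h10, h11, h12⟩ :=
    exists_srcClasses_of_bkg F U₀ C_B α hCB hα hpos hL hBKG h24 hSU
  have hkα0 : (0 : ℝ) ≤ ((((F.P K).d + 2) * (F.P K).L : ℕ) : ℝ) ^ 2 / 4 := by positivity
  have hup := two_mul_bkgClass_le_of_le F (K := K) (J := J) C_B α hCθ
  refine ⟨αc, δc, αpc, αpbc, h1, h2, h3, h4, h5, h6, h7, h8, h9, h10, h11, fun i hi => ?_, fun i hi => ?_, fun i hi => ?_⟩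
  · exact (h12 i hi).1.trans (hup i)
  · exact (h12 i hi).2.1.trans (mul_le_mul_of_nonneg_left (hup i) hkα0)
  · exact (h12 i hi).2.2.trans (mul_le_mul_of_nonneg_left (hup i) (by positivity))

end Package

end Summit.QuantumFields.YangMills.Theorems.FluctuationComparisonRegPrIntLS2BetaSourceClassesOfBkg
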